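import Mathlib.Analysis.InnerProductSpace.PiL2
import Mathlib.Analysis.InnerProductSpace.Calculus
import Mathlib.Analysis.SpecialFunctions.Trigonometric.Basic
import HarnessLib

/-!
# The bipolar (circle) field of two points of `ℝ³`

Topic `Geometry/Conformal`; namespace `Literature.Geometry.Conformal`. Definition request
`defn-bipolarField` of route CriticalPhenomena/MeanCurrentCircleLaw (items
stmt-CriticalPhenomena-7080 `CircleLaw`, 7084 `BipolarUniqueness`, 7085 `GaussianWronskianRung`,
which inline the term below verbatim).

For `x, y ∈ ℝ³` the **bipolar field from `x` to `y`** is the vector field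
`B_{x,y}(z) = (‖x - y‖ / (4π ‖z - x‖ ‖z - y‖)) · ((z - x)/‖z - x‖² - (z - y)/‖z - y‖²)`,
i.e. the normalised Wronskian `(G_x ∇G_y - G_y ∇G_x)/G(x, y)` of the Newtonian potentials
`G_x(z) = 1/(4π ‖z - x‖)` (`∇G_x = -(z - x)/(4π‖z - x‖³)`): the probability current of Brownian
motion started at `x` and conditioned to hit `y` (Doob `h`-transform with `h = G_y`). Its field
lines are the circles through `x` and `y` (the pencil of circles of bipolar coordinates), oriented
from `x` to `y`; the two-point stabiliser of the Möbius group of `ℝ³ ∪ {∞}` (`≅ ℝ₊ × O(2)`-type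
subgroup of loxodromic/elliptic elements fixing `x` and `y`; Beardon, *The Geometry of Discrete
Groups* (1983), §3) permutes these circles, which is the symmetry the route exploits.

## Contents

* `bipolarField x y z` — the definition (the route's term, verbatim);
* `bipolarField_self`, `bipolarField_left`, `bipolarField_right` — degenerate values: `B_{x,x} = 0`,
  and the junk value `0` at the two poles `z = x`, `z = y` (there `‖z - x‖ = 0`, and real division
  by `0` is `0`);
* `bipolarField_swap` — `B_{y,x} = -B_{x,y}`;
* `norm_inner_bipolar` and `norm_bipolarField` — off the poles,
  `‖(z - x)/‖z - x‖² - (z - y)/‖z - y‖²‖ = ‖x - y‖/(‖z - x‖ ‖z - y‖)` (the inversion identity,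
  Mathlib `dist_div_norm_sq_smul`) and hence `‖B_{x,y}(z)‖ = ‖x - y‖² / (4π ‖z - x‖² ‖z - y‖²)`;
* `contDiffAt_bipolarField` — `B_{x,y}` is `C^n` at every `z ∉ {x, y}`.

Not proved here (expected by the requesting route, left to its provers): the weak divergence
identity `∫ ⟪B_{x,y}, ∇f⟫ = f y - f x` (`div B = δ_x - δ_y`), local integrability on `ℝ³`
(`‖B‖ ~ 1/(4π‖z - x‖²)` at the poles), the transformation rule under inversions in spheres
through `x` and `y`, the equatorial flux and the far-field expansion.

## References

* A. F. Beardon, *The Geometry of Discrete Groups*, GTM 91 (1983), §3 (Möbius transformations of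
  `ℝⁿ ∪ {∞}`, inversions, stabilisers). [Beardon1983]
* R. Lyons, Y. Peres, *Probability on Trees and Networks* (2016), §2.2, §4.2 (currents as
  gradients of potentials; transfer currents). [LyonsPeres2016]
-/

noncomputable section

namespace Literature.Geometry.Conformal

open Real

/-- The **bipolar field** from `x` to `y` in `ℝ³`, evaluated at `z`:
`(‖x - y‖ / (4π ‖z - x‖ ‖z - y‖)) • ((‖z - x‖²)⁻¹ • (z - x) - (‖z - y‖²)⁻¹ • (z - y))` — the
normalised Wronskian of the Newtonian potentials of `x` and `y`, whose field lines are the circles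
through `x` and `y` oriented from `x` to `y`, with `‖B‖ = ‖x - y‖²/(4π‖z - x‖²‖z - y‖²)`
(`norm_bipolarField`). At the poles `z = x`, `z = y` the value is the junk value `0` (real
division by zero). This is verbatim the term inlined in items 7080/7084/7085 of route
CriticalPhenomena/MeanCurrentCircleLaw. [folklore] -/
def bipolarField (x y z : EuclideanSpace ℝ (Fin 3)) : EuclideanSpace ℝ (Fin 3) :=
  (‖x - y‖ / (4 * Real.pi * ‖z - x‖ * ‖z - y‖)) •
    ((‖z - x‖ ^ 2)⁻¹ • (z - x) - (‖z - y‖ ^ 2)⁻¹ • (z - y))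

variable (x y z : EuclideanSpace ℝ (Fin 3))

/-- Unfolding lemma (`rfl`). [folklore] -/
theorem bipolarField_def :
    bipolarField x y z =
      (‖x - y‖ / (4 * Real.pi * ‖z - x‖ * ‖z - y‖)) •
        ((‖z - x‖ ^ 2)⁻¹ • (z - x) - (‖z - y‖ ^ 2)⁻¹ • (z - y)) :=
  rfl

/-- Degenerate pair: `B_{x,x} = 0`. [folklore] -/
@[simp]
theorem bipolarField_self : bipolarField x x z = 0 := by
  simp [bipolarField]

/-- Junk value at the first pole: `B_{x,y}(x) = 0` (the coefficient has `‖x - x‖ = 0` in its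
denominator). [folklore] -/
@[simp]
theorem bipolarField_left : bipolarField x y x = 0 := by
  simp [bipolarField]

/-- Junk value at the second pole: `B_{x,y}(y) = 0`. [folklore] -/
@[simp]
theorem bipolarField_right : bipolarField x y y = 0 := by
  simp [bipolarField]

/-- Antisymmetry in the two points: `B_{y,x} = -B_{x,y}` (reversing the orientation of the
circles). [folklore] -/
theorem bipolarField_swap : bipolarField y x z = -bipolarField x y z := by
  simp only [bipolarField, norm_sub_rev y x, ← smul_neg, neg_sub]
  congr 1
  ring

variable {x y z}

/-- **The inversion identity** behind the bipolar field: for `z ∉ {x, y}`,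
`‖(z - x)/‖z - x‖² - (z - y)/‖z - y‖²‖ = ‖x - y‖ / (‖z - x‖ ‖z - y‖)` (the images of `x` and `y`
under the inversion in the unit sphere centred at `z` are at distance `‖x - y‖/(‖z - x‖‖z - y‖)`;
Mathlib `dist_div_norm_sq_smul`, `EuclideanGeometry.dist_inversion_inversion`). [folklore] -/
theorem norm_inner_bipolar (hx : z ≠ x) (hy : z ≠ y) :
    ‖(‖z - x‖ ^ 2)⁻¹ • (z - x) - (‖z - y‖ ^ 2)⁻¹ • (z - y)‖ = ‖x - y‖ / (‖z - x‖ * ‖z - y‖) := by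
  have ha : z - x ≠ 0 := sub_ne_zero.mpr hx
  have hb : z - y ≠ 0 := sub_ne_zero.mpr hy
  have h := dist_div_norm_sq_smul ha hb 1
  rw [dist_eq_norm, dist_eq_norm, sub_sub_sub_cancel_left, norm_sub_rev y x] at h
  simpa only [one_div, inv_pow, one_pow, div_eq_inv_mul (‖x - y‖)] using h

/-- **Magnitude of the bipolar field**: for `z ∉ {x, y}`,
`‖B_{x,y}(z)‖ = ‖x - y‖² / (4π ‖z - x‖² ‖z - y‖²)`. [folklore] -/
theorem norm_bipolarField (hx : z ≠ x) (hy : z ≠ y) :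
    ‖bipolarField x y z‖ = ‖x - y‖ ^ 2 / (4 * π * ‖z - x‖ ^ 2 * ‖z - y‖ ^ 2) := by
  have ha : 0 < ‖z - x‖ := norm_pos_iff.mpr (sub_ne_zero.mpr hx)
  have hb : 0 < ‖z - y‖ := norm_pos_iff.mpr (sub_ne_zero.mpr hy)
  rw [bipolarField, norm_smul, norm_inner_bipolar hx hy, Real.norm_of_nonneg (by positivity)]
  field_simp

/-- Off the poles and for `x ≠ y` the bipolar field does not vanish (its norm is
`‖x - y‖²/(4π‖z - x‖²‖z - y‖²) > 0`). [folklore] -/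
theorem bipolarField_ne_zero (hxy : x ≠ y) (hx : z ≠ x) (hy : z ≠ y) : bipolarField x y z ≠ 0 := by
  have ha : 0 < ‖z - x‖ := norm_pos_iff.mpr (sub_ne_zero.mpr hx)
  have hb : 0 < ‖z - y‖ := norm_pos_iff.mpr (sub_ne_zero.mpr hy)
  have hc : 0 < ‖x - y‖ := norm_pos_iff.mpr (sub_ne_zero.mpr hxy)
  have hpi := Real.pi_pos
  rw [← norm_pos_iff, norm_bipolarField hx hy]
  positivity

/-- **Smoothness off the poles**: `B_{x,y}` is `C^n` at every `z ≠ x, y` (a composition of the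
norm — smooth away from `0` — with field operations whose denominators do not vanish there).
[folklore] -/
theorem contDiffAt_bipolarField {n : WithTop ℕ∞} (hx : z ≠ x) (hy : z ≠ y) :
    ContDiffAt ℝ n (bipolarField x y) z := by
  have ha : z - x ≠ 0 := sub_ne_zero.mpr hx
  have hb : z - y ≠ 0 := sub_ne_zero.mpr hy
  have h1 : ContDiffAt ℝ n (fun w : EuclideanSpace ℝ (Fin 3) => ‖w - x‖) z :=
    (contDiffAt_id.sub contDiffAt_const).norm ℝ ha
  have h2 : ContDiffAt ℝ n (fun w : EuclideanSpace ℝ (Fin 3) => ‖w - y‖) z :=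
    (contDiffAt_id.sub contDiffAt_const).norm ℝ hb
  have hden : 4 * Real.pi * ‖z - x‖ * ‖z - y‖ ≠ 0 := by
    have := Real.pi_pos
    have := norm_pos_iff.mpr ha
    have := norm_pos_iff.mpr hb
    positivity
  unfold bipolarField
  refine ContDiffAt.smul (contDiffAt_const.div ((contDiffAt_const.mul h1).mul h2) hden) ?_
  refine ContDiffAt.sub ?_ ?_
  · exact ((h1.pow 2).inv (by positivity)).smul (contDiffAt_id.sub contDiffAt_const)
  · exact ((h2.pow 2).inv (by positivity)).smul (contDiffAt_id.sub contDiffAt_const)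

/-- Continuity off the poles (from `contDiffAt_bipolarField` with `n = 0`). [folklore] -/
theorem continuousAt_bipolarField (hx : z ≠ x) (hy : z ≠ y) :
    ContinuousAt (bipolarField x y) z :=
  (contDiffAt_bipolarField (n := 0) hx hy).continuousAt

end Literature.Geometry.Conformal

end
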